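import Literature.AnabelianGeometry.SemiGraphs.PSCSeparatingCoveringsThreeChainPointed
import Literature.AnabelianGeometry.SemiGraphs.PSCSeparatingCoveringsTwoComponentUnmarkedEdgesOneCusp
import HarnessLib

/-!
# [CombGC] Prop. 1.2, proof p. 9: VERTICIAL separating coverings at THREE-COMPONENT CHAINS with an UNMARKED FIRST component (row F-2826)

Mochizuki, *A combinatorial version of the Grothendieck conjecture*, Tohoku Math. J. **59** (2007)
[CombGC], PROOF of Proposition 1.2, p. 9: "if `v₁ ≠ v₂` …, then there exists a finite étale … covering
`G' → G` whose restriction to the anabelioid `G_{v₂}` is trivial …, but whose restriction to `G_{v₁}` is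
nontrivial" [cite: MochizukiCombGC2007, Prop 1.2 proof p.9]; typed LEVEL-WISE as
`PSCDatum.VerticialSeparatingCoverings` (abc-iut-w4-d081, row P12-L01-V; abc-iut FACT-LIST row F-2826 — a
schema whose universal closure is refuted as typed; the instance forms at genuine carriers are the content).

PROOF-ONLY file (abc-iut-f-166 gen 6, row «UNMARKED-FIRST-CHAIN», file 2; 0 definitions).  The carrier:
abc-iut-f-164's three-component chain `C₀ ∪_{ν_A} C_mid ∪_{ν_B} C₁` with the FIRST component UNMARKED
(`s₂ = r`, `1 ≤ s₁ < r`, `1 ≤ g₀ ≤ g₁`, `C₁` stable), over a profinite pro-`Σ` completion `ι : Γ_{g,r} → Π`.  In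
the node-loop basis `b_B` of `(g₁, s₁)` (which carries `η`): `Π_{v₀} = cl ι⟨a_i, b_i (i < g₀)⟩` and
`Π_{v₁} = cl ι⟨b_B(T₁)⟩` (abc-iut-f-164's `closure_secondSubsurface_eq_nodeLoopBasis` with parameters
`(g₁, s₁)`) are free-factor closures, while the middle group is `Π_{v_mid} = cl ι⟨b_B(S_mid) ∪ {ε_A}⟩`
(`closure_chainMid_unmarkedFirst_eq`: `c_{s₁}` recovered from `η = c_{s₁}·(c_{s₁+1}⋯c_{r−1})·ε_A·∏_{g₀≤i<g₁}[a_i,b_i]`)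
with `ε_A = ∏_{i<g₀}[a_i,b_i]` the boundary word of the neighbouring handle factor — the CUT-OFF shape of
abc-iut-f-164's `cutoff_exists_open_separating_sameVertex` with `Ψ = η^∨`.  Cross pairs by free-factor projections
(witnesses `η`, `a₀`, and `ε_A ≠ 1` — detected by a Heisenberg handle-cusp homomorphism) and, for the killed
middle vertex, the character dual to an end letter mod `ℓ^{[Π:V]}` through `exists_open_separating_of_hom`.

* `closure_chainMid_unmarkedFirst_eq` — the middle vertex group in the basis `b_B`;
* `verticialSeparatingCoverings_of_threeChain_unmarkedFirst` — **F-2826** (`V' := V`) at EVERY such datum.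

Instance forms at data of the shape of genuine stable curves: consistency evidence for the typed schema, not
the printed theorem for all pointed stable curves.  Nothing here takes a side on [IUTchIII] Cor. 3.12.
-/

noncomputable section

/-! ### The middle vertex group when the first component is unmarked -/

namespace Literature.GroupTheory.CombinatorialGroupTheory.PuncturedSurfaceGroup

variable {g r' g₀ g₁ s₁ : ℕ} {εA η : PuncturedSurfaceGroup g (r' + 1)}
  {B : FreeGroupBasis ((Fin g × Bool) ⊕ Fin r') (PuncturedSurfaceGroup g (r' + 1))}

/-- **The middle component of a chain whose first component is unmarked**, in the node-loop basis `B` of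
`(g₁, s₁)` (`B` carries `a_i`, `b_i`, the `c_{j+1}` off slot `s₁ − 1`, and `η` at slot `s₁ − 1`): for
`1 ≤ s₁ ≤ r'`, `g₀ ≤ g₁`,
`⟨a_i, b_i (g₀ ≤ i < g₁), c_j (s₁ ≤ j), ε_A, η⟩ = ⟨B(S_mid) ∪ {ε_A}⟩`, `S_mid = {(i,·) : g₀ ≤ i < g₁} ∪ {j : s₁ ≤ j+1}`
— the marked point `c_{s₁}` is recovered from `η = c_{s₁} (c_{s₁+1}⋯c_{r'}) ε_A ∏_{g₀≤i<g₁}[a_i,b_i]`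
(`secondLoop_eq_c_mul` with `s₂ = r' + 1`). [cite: MochizukiSemiAnbd2006, Ex. 2.10 p.31] -/
theorem closure_chainMid_unmarkedFirst_eq
    (hεA : εA = ((List.finRange (r' + 1)).map fun j : Fin (r' + 1) =>
        if r' + 1 ≤ (j : ℕ) then c (g := g) j else 1).prod *
      ((List.finRange g).map fun i : Fin g => if (i : ℕ) < g₀ then
        a (r := r' + 1) i * b i * (a i)⁻¹ * (b i)⁻¹ else 1).prod)
    (hη : η = ((List.finRange (r' + 1)).map fun j : Fin (r' + 1) =>
        if s₁ ≤ (j : ℕ) then c (g := g) j else 1).prod *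
      ((List.finRange g).map fun i : Fin g => if (i : ℕ) < g₁ then
        a (r := r' + 1) i * b i * (a i)⁻¹ * (b i)⁻¹ else 1).prod)
    (ha : ∀ i, B (Sum.inl (i, false)) = a i) (hb : ∀ i, B (Sum.inl (i, true)) = b i)
    (hc : ∀ j : Fin r', (j : ℕ) + 1 ≠ s₁ → B (Sum.inr j) = c (Fin.succ j))
    (hB : ∀ h : s₁ - 1 < r', B (Sum.inr ⟨s₁ - 1, h⟩) = η) (hg : g₀ ≤ g₁) (hs₁ : 1 ≤ s₁) (hsr : s₁ ≤ r') :
    Subgroup.closure {x : PuncturedSurfaceGroup g (r' + 1) |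
        (∃ i : Fin g, (g₀ ≤ (i : ℕ) ∧ (i : ℕ) < g₁) ∧ (x = a i ∨ x = b i)) ∨
          (∃ j : Fin (r' + 1), (s₁ ≤ (j : ℕ) ∧ (j : ℕ) < r' + 1) ∧ x = c j) ∨ x = εA ∨ x = η} =
      Subgroup.closure (B '' {x | Sum.elim (fun p : Fin g × Bool => g₀ ≤ (p.1 : ℕ) ∧ (p.1 : ℕ) < g₁)
        (fun j : Fin r' => s₁ ≤ (j : ℕ) + 1) x} ∪ {εA}) := by
  classical
  set Sm : Set ((Fin g × Bool) ⊕ Fin r') := {x | Sum.elim (fun p : Fin g × Bool => g₀ ≤ (p.1 : ℕ) ∧ (p.1 : ℕ) < g₁)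
    (fun j : Fin r' => s₁ ≤ (j : ℕ) + 1) x} with hSm
  have hml : ∀ p : Fin g × Bool, (Sum.inl p : (Fin g × Bool) ⊕ Fin r') ∈ Sm ↔
      g₀ ≤ (p.1 : ℕ) ∧ (p.1 : ℕ) < g₁ := fun _ => Iff.rfl
  have hmr : ∀ j : Fin r', (Sum.inr j : (Fin g × Bool) ⊕ Fin r') ∈ Sm ↔ s₁ ≤ (j : ℕ) + 1 := fun _ => Iff.rfl
  set R := Subgroup.closure (B '' Sm ∪ {εA}) with hR
  have hmemR : ∀ x, x ∈ Sm → B x ∈ R := fun x hx => Subgroup.subset_closure (Or.inl ⟨x, hx, rfl⟩)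
  have hεR : εA ∈ R := Subgroup.subset_closure (Or.inr rfl)
  have haR : ∀ i : Fin g, g₀ ≤ (i : ℕ) → (i : ℕ) < g₁ → a (r := r' + 1) i ∈ R := fun i h1 h2 => by
    rw [← ha i]; exact hmemR _ ((hml _).mpr ⟨h1, h2⟩)
  have hbR : ∀ i : Fin g, g₀ ≤ (i : ℕ) → (i : ℕ) < g₁ → b (r := r' + 1) i ∈ R := fun i h1 h2 => by
    rw [← hb i]; exact hmemR _ ((hml _).mpr ⟨h1, h2⟩)
  have hηR : η ∈ R := by rw [← hB (by omega)]; exact hmemR _ ((hmr _).mpr (by simp only; omega))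
  -- `c_j ∈ R` for `s₁ < j ≤ r'` (basis members)
  have hcR : ∀ j : Fin (r' + 1), s₁ < (j : ℕ) → c (g := g) j ∈ R := by
    intro j hj1
    have hj0 : (j : ℕ) ≠ 0 := by omega
    have e1 : B (Sum.inr (j.pred (fun h => hj0 (by rw [h]; rfl)))) = c j := by
      rw [hc _ (by rw [Fin.val_pred]; omega), Fin.succ_pred]
    rw [← e1]
    exact hmemR _ ((hmr _).mpr (by rw [Fin.val_pred]; omega))
  -- `c_{s₁} ∈ R`: `η = c_{s₁} · W`, `W ∈ R`
  have hcsR : c (g := g) ⟨s₁, by omega⟩ ∈ R := by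
    have hW : ((List.finRange (r' + 1)).map fun j : Fin (r' + 1) =>
          if s₁ + 1 ≤ (j : ℕ) ∧ (j : ℕ) < r' + 1 then c (g := g) j else 1).prod * εA *
        ((List.finRange g).map fun i : Fin g => if g₀ ≤ (i : ℕ) ∧ (i : ℕ) < g₁ then
          a (r := r' + 1) i * b i * (a i)⁻¹ * (b i)⁻¹ else 1).prod ∈ R :=
      R.mul_mem (R.mul_mem (prod_map_finRange_ite_mem _ _ _ _ fun j hj => hcR j (by omega)) hεR)
        (comm_prod_ite_mem _ _ (fun i hi => haR i hi.1 hi.2) (fun i hi => hbR i hi.1 hi.2))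
    have hrel := secondLoop_eq_c_mul (s₂ := r' + 1) hεA hη hg (by omega) (by omega)
    rw [eq_mul_inv_of_mul_eq hrel.symm]
    exact R.mul_mem hηR (R.inv_mem hW)
  apply le_antisymm
  · rw [Subgroup.closure_le]
    rintro x (⟨i, ⟨h1, h2⟩, rfl | rfl⟩ | ⟨j, ⟨hj, -⟩, rfl⟩ | rfl | rfl)
    · exact haR i h1 h2
    · exact hbR i h1 h2
    · by_cases hjs : (j : ℕ) = s₁
      · have : j = ⟨s₁, by omega⟩ := Fin.ext hjs
        rw [this]; exact hcsR
      · exact hcR j (by omega)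
    · exact hεR
    · exact hηR
  · rw [Subgroup.closure_le]
    rintro x (⟨y, hy, rfl⟩ | rfl)
    · apply Subgroup.subset_closure
      rcases y with ⟨i, _ | _⟩ | j
      · exact Or.inl ⟨i, (hml _).mp hy, Or.inl (ha i)⟩
      · exact Or.inl ⟨i, (hml _).mp hy, Or.inr (hb i)⟩
      · have hj : s₁ ≤ (j : ℕ) + 1 := (hmr _).mp hy
        by_cases hjs : (j : ℕ) + 1 = s₁
        · have : j = ⟨s₁ - 1, by omega⟩ := Fin.ext (by simp only; omega)
          rw [this, hB (by omega)]
          exact Or.inr (Or.inr (Or.inr rfl))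
        · rw [hc j hjs]
          exact Or.inr (Or.inl ⟨Fin.succ j, ⟨by rw [Fin.val_succ]; omega, by rw [Fin.val_succ]; omega⟩, rfl⟩)
    · exact Subgroup.subset_closure (Or.inr (Or.inr (Or.inl rfl)))

end Literature.GroupTheory.CombinatorialGroupTheory.PuncturedSurfaceGroup

namespace Literature.AnabelianGeometry.SemiGraphs

namespace PSCDatum

open scoped Pointwise
open Multiplicative
open Literature.AnabelianGeometry.Anabelioids (IsSigmaInteger)
open Literature.GroupTheory.CombinatorialGroupTheory
open Literature.GroupTheory.CombinatorialGroupTheory.PuncturedSurfaceGroup (a b c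
  exists_freeGroupBasis_nodeLoop closure_secondSubsurface_eq_nodeLoopBasis closure_chainMid_unmarkedFirst_eq
  comm_prod_ite_mem exists_hom_handle_cusp hom_handle_cusp_nodeLoop)
open Literature.GroupTheory.CombinatorialGroupTheory.FreeFactorFibredTwist (lift_apply_basis)
open SemiGraphOfAnabelioids (IsProSigmaCompletion)
open SemiGraphOfAnabelioids.IsProSigmaCompletion (freeFactor_exists_open_separating_sameVertex
  freeFactor_exists_open_separating_crossVertex cutoff_exists_open_separating_sameVertex
  exists_open_separating_of_hom)

variable {P : Type} [Group P] [TopologicalSpace P] [IsTopologicalGroup P]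
variable [CompactSpace P] [TotallyDisconnectedSpace P] {Sigma : Set ℕ} {g r : ℕ}

/-- **Row P12-L01-V / F-2826 (`VerticialSeparatingCoverings`, `V' := V`) at EVERY three-component chain datum
whose first component is UNMARKED** (`s₂ = r`, `1 ≤ s₁ < r`, `1 ≤ g₀ ≤ g₁ ≤ g`, `C₁` stable).
[cite: MochizukiCombGC2007, Prop 1.2 proof p.9] -/
theorem verticialSeparatingCoverings_of_threeChain_unmarkedFirst (hne : Sigma.Nonempty)
    (hprime : ∀ p ∈ Sigma, p.Prime) (ι : PuncturedSurfaceGroup g r →* P)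
    (hι : IsProSigmaCompletion Sigma ι) (G : PSCDatum P) {g₀ g₁ s₁ s₂ : ℕ} (hg₀ : 1 ≤ g₀) (hg : g₀ ≤ g₁)
    (hg₁ : g₁ ≤ g) (hs₁ : 1 ≤ s₁) (hs₁r : s₁ < r) (hs₂ : s₂ = r) (hst₁ : 1 ≤ g - g₁ ∨ 2 ≤ s₁)
    (v₀ vm v₁ : G.graph.V) (hV : ∀ w, w = v₀ ∨ w = vm ∨ w = v₁) (εA η : PuncturedSurfaceGroup g r)
    (hεA : εA = ((List.finRange r).map fun j : Fin r =>
          if s₂ ≤ (j : ℕ) then PuncturedSurfaceGroup.c (g := g) j else 1).prod *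
        ((List.finRange g).map fun i : Fin g => if (i : ℕ) < g₀ then
          PuncturedSurfaceGroup.a (r := r) i * PuncturedSurfaceGroup.b i *
            (PuncturedSurfaceGroup.a i)⁻¹ * (PuncturedSurfaceGroup.b i)⁻¹ else 1).prod)
    (hη : η = ((List.finRange r).map fun j : Fin r =>
          if s₁ ≤ (j : ℕ) then PuncturedSurfaceGroup.c (g := g) j else 1).prod *
        ((List.finRange g).map fun i : Fin g => if (i : ℕ) < g₁ then
          PuncturedSurfaceGroup.a (r := r) i * PuncturedSurfaceGroup.b i *
            (PuncturedSurfaceGroup.a i)⁻¹ * (PuncturedSurfaceGroup.b i)⁻¹ else 1).prod)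
    (hV₀ : G.vertGp v₀ = ((Subgroup.closure {x : PuncturedSurfaceGroup g r |
        (∃ i : Fin g, (i : ℕ) < g₀ ∧ (x = PuncturedSurfaceGroup.a i ∨ x = PuncturedSurfaceGroup.b i)) ∨
        ∃ j : Fin r, s₂ ≤ (j : ℕ) ∧ x = PuncturedSurfaceGroup.c j}).map ι).topologicalClosure)
    (hVm : G.vertGp vm = ((Subgroup.closure {x : PuncturedSurfaceGroup g r |
        (∃ i : Fin g, (g₀ ≤ (i : ℕ) ∧ (i : ℕ) < g₁) ∧
          (x = PuncturedSurfaceGroup.a i ∨ x = PuncturedSurfaceGroup.b i)) ∨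
        (∃ j : Fin r, (s₁ ≤ (j : ℕ) ∧ (j : ℕ) < s₂) ∧ x = PuncturedSurfaceGroup.c j) ∨
        x = εA ∨ x = η}).map ι).topologicalClosure)
    (hV₁ : G.vertGp v₁ = ((Subgroup.closure {x : PuncturedSurfaceGroup g r |
        (∃ i : Fin g, g₁ ≤ (i : ℕ) ∧ (x = PuncturedSurfaceGroup.a i ∨ x = PuncturedSurfaceGroup.b i)) ∨
        (∃ j : Fin r, (j : ℕ) < s₁ ∧ x = PuncturedSurfaceGroup.c j) ∨ x = η}).map ι).topologicalClosure) :
    G.VerticialSeparatingCoverings := by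
  classical
  subst s₂
  obtain ⟨r', rfl⟩ : ∃ r', r = r' + 1 := ⟨r - 1, by omega⟩
  obtain ⟨ℓ, hℓS⟩ := hne
  have hℓ : ℓ.Prime := hprime ℓ hℓS
  have hSig : ∃ ℓ ∈ Sigma, ℓ.Prime := ⟨ℓ, hℓS, hℓ⟩
  -- the node-loop basis of `(g₁, s₁)`
  obtain ⟨bB, ha, hb, hc, hkB⟩ := exists_freeGroupBasis_nodeLoop g r' g₁ s₁ hs₁ (by omega) η hη
  have hk : ∀ h : s₁ - 1 < r', bB (Sum.inr ⟨s₁ - 1, h⟩) = η := fun _ => hkB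
  have hslot : s₁ - 1 < r' := by omega
  -- the three index sets
  obtain ⟨S₀, hS₀⟩ : ∃ S : Set ((Fin g × Bool) ⊕ Fin r'),
      S = {x | Sum.elim (fun p : Fin g × Bool => (p.1 : ℕ) < g₀) (fun _ : Fin r' => False) x} := ⟨_, rfl⟩
  obtain ⟨Sm, hSm⟩ : ∃ S : Set ((Fin g × Bool) ⊕ Fin r'),
      S = {x | Sum.elim (fun p : Fin g × Bool => g₀ ≤ (p.1 : ℕ) ∧ (p.1 : ℕ) < g₁)
        (fun j : Fin r' => s₁ ≤ (j : ℕ) + 1) x} := ⟨_, rfl⟩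
  obtain ⟨S₁, hS₁⟩ : ∃ S : Set ((Fin g × Bool) ⊕ Fin r'),
      S = {x | Sum.elim (fun p : Fin g × Bool => g₁ ≤ (p.1 : ℕ)) (fun j : Fin r' => (j : ℕ) + 1 ≤ s₁) x} :=
    ⟨_, rfl⟩
  have h0l : ∀ p : Fin g × Bool, (Sum.inl p : (Fin g × Bool) ⊕ Fin r') ∈ S₀ ↔ (p.1 : ℕ) < g₀ :=
    fun _ => by rw [hS₀]; exact Iff.rfl
  have h0r : ∀ j : Fin r', (Sum.inr j : (Fin g × Bool) ⊕ Fin r') ∉ S₀ := fun _ h => by rw [hS₀] at h; exact h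
  have hml : ∀ p : Fin g × Bool, (Sum.inl p : (Fin g × Bool) ⊕ Fin r') ∈ Sm ↔
      g₀ ≤ (p.1 : ℕ) ∧ (p.1 : ℕ) < g₁ := fun _ => by rw [hSm]; exact Iff.rfl
  have hmr : ∀ j : Fin r', (Sum.inr j : (Fin g × Bool) ⊕ Fin r') ∈ Sm ↔ s₁ ≤ (j : ℕ) + 1 :=
    fun _ => by rw [hSm]; exact Iff.rfl
  have h1l : ∀ p : Fin g × Bool, (Sum.inl p : (Fin g × Bool) ⊕ Fin r') ∈ S₁ ↔ g₁ ≤ (p.1 : ℕ) :=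
    fun _ => by rw [hS₁]; exact Iff.rfl
  have h1r : ∀ j : Fin r', (Sum.inr j : (Fin g × Bool) ⊕ Fin r') ∈ S₁ ↔ (j : ℕ) + 1 ≤ s₁ :=
    fun _ => by rw [hS₁]; exact Iff.rfl
  -- `ε_A` is the closed-surface loop `∏_{i<g₀}[a_i,b_i]`; `ε_A ≠ 1`
  have hcusp1 : ((List.finRange (r' + 1)).map fun j : Fin (r' + 1) =>
      if r' + 1 ≤ (j : ℕ) then PuncturedSurfaceGroup.c (g := g) j else 1).prod = 1 :=
    List.prod_eq_one fun y hy => by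
      obtain ⟨j, -, rfl⟩ := List.mem_map.mp hy
      exact if_neg (by omega)
  have hεx : εA = ((List.finRange g).map fun i : Fin g => if (i : ℕ) < g₀ then
      a (r := r' + 1) i * b i * (a i)⁻¹ * (b i)⁻¹ else 1).prod := by rw [hεA, hcusp1, one_mul]
  have hεmem : εA ∈ Subgroup.closure (bB '' {y | y ∉ Sm ∧ y ∉ S₁}) := by
    rw [hεx]
    refine comm_prod_ite_mem _ _ (fun i hi => ?_) (fun i hi => ?_)
    · rw [← ha i]
      exact Subgroup.subset_closure ⟨_, ⟨fun h => by have := (hml _).mp h; simp only at this; omega,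
        fun h => by have := (h1l _).mp h; simp only at this; omega⟩, rfl⟩
    · rw [← hb i]
      exact Subgroup.subset_closure ⟨_, ⟨fun h => by have := (hml _).mp h; simp only at this; omega,
        fun h => by have := (h1l _).mp h; simp only at this; omega⟩, rfl⟩
  have hε1 : εA ≠ 1 := by
    obtain ⟨φ, X, Y, Z, hXYZ, -, hZpow, -⟩ := Heisenberg.exists_heisenbergTriple_central 2
    have hZ1 : Z ≠ 1 := fun h => by have h2 : 2 ∣ 1 := (hZpow 1).mp (by rw [pow_one, h]); omega
    obtain ⟨ψ, ha', hb', hc', hab, hcj⟩ := exists_hom_handle_cusp (g := g) (r := r' + 1) ⟨0, by omega⟩ 0 X Y Z⁻¹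
      (by rw [hXYZ, mul_inv_cancel])
    intro h
    have hψ : ψ εA = Z := by
      rw [hεA, hom_handle_cusp_nodeLoop ψ ha' hb' hc' hab hcj g₀ (r' + 1), if_neg (not_le.mpr (Fin.is_lt _)),
        if_pos (show ((⟨0, _⟩ : Fin g) : ℕ) < g₀ by simp only; omega), one_mul, hXYZ]
    rw [h, map_one] at hψ
    exact hZ1 hψ.symm
  -- the three vertex groups
  have hA₀ : G.vertGp v₀ = ((Subgroup.closure (bB '' S₀)).map ι).topologicalClosure := by
    rw [hV₀]
    congr 2
    apply le_antisymm
    · rw [Subgroup.closure_le]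
      rintro x (⟨i, hi, rfl | rfl⟩ | ⟨j, hj, -⟩)
      · exact Subgroup.subset_closure ⟨Sum.inl (i, false), (h0l _).mpr hi, ha i⟩
      · exact Subgroup.subset_closure ⟨Sum.inl (i, true), (h0l _).mpr hi, hb i⟩
      · exact absurd hj (by omega)
    · rw [Subgroup.closure_le]
      rintro _ ⟨y, hy, rfl⟩
      apply Subgroup.subset_closure
      rcases y with ⟨i, _ | _⟩ | j
      · exact Or.inl ⟨i, (h0l _).mp hy, Or.inl (ha i)⟩
      · exact Or.inl ⟨i, (h0l _).mp hy, Or.inr (hb i)⟩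
      · exact absurd hy (h0r j)
  have hAm : G.vertGp vm = ((Subgroup.closure (bB '' Sm ∪ {εA})).map ι).topologicalClosure := by
    rw [hVm, hSm, closure_chainMid_unmarkedFirst_eq hεA hη ha hb hc hk hg hs₁ (by omega)]
  have hA₁ : G.vertGp v₁ = ((Subgroup.closure (bB '' S₁)).map ι).topologicalClosure := by
    rw [hV₁, hS₁, closure_secondSubsurface_eq_nodeLoopBasis hη ha hb hc hk hs₁ (by omega)]
  -- membership helpers and witnesses
  have hcl : ∀ (S : Set ((Fin g × Bool) ⊕ Fin r')) (T : Set (PuncturedSurfaceGroup g (r' + 1))) (y), y ∈ S →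
      ι (bB y) ∈ ((Subgroup.closure (bB '' S ∪ T)).map ι).topologicalClosure := fun S T y hy =>
    Subgroup.le_topologicalClosure _ (Subgroup.mem_map_of_mem ι (Subgroup.subset_closure (Or.inl ⟨y, hy, rfl⟩)))
  have hcl' : ∀ (S : Set ((Fin g × Bool) ⊕ Fin r')) (y), y ∈ S →
      ι (bB y) ∈ ((Subgroup.closure (bB '' S)).map ι).topologicalClosure := fun S y hy =>
    Subgroup.le_topologicalClosure _ (Subgroup.mem_map_of_mem ι (Subgroup.subset_closure ⟨y, hy, rfl⟩))
  have hτBm : (Sum.inr ⟨s₁ - 1, hslot⟩ : (Fin g × Bool) ⊕ Fin r') ∈ Sm := (hmr _).mpr (by simp only; omega)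
  have hτB1 : (Sum.inr ⟨s₁ - 1, hslot⟩ : (Fin g × Bool) ⊕ Fin r') ∈ S₁ := (h1r _).mpr (by simp only; omega)
  have hτB0 : (Sum.inr ⟨s₁ - 1, hslot⟩ : (Fin g × Bool) ⊕ Fin r') ∉ S₀ := h0r _
  have hκ0 : (Sum.inl (⟨0, by omega⟩, false) : (Fin g × Bool) ⊕ Fin r') ∈ S₀ := (h0l _).mpr (by simp only; omega)
  have hκm : (Sum.inl (⟨0, by omega⟩, false) : (Fin g × Bool) ⊕ Fin r') ∉ Sm := fun h => by
    have := (hml _).mp h; simp only at this; omega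
  have hκ1 : (Sum.inl (⟨0, by omega⟩, false) : (Fin g × Bool) ⊕ Fin r') ∉ S₁ := fun h => by
    have := (h1l _).mp h; simp only at this; omega
  -- a letter of `C₁` outside `Sm` (stability of `C₁`)
  obtain ⟨x₁, hx₁1, hx₁m⟩ : ∃ x, x ∈ S₁ ∧ x ∉ Sm := by
    rcases hst₁ with h | h
    · exact ⟨Sum.inl (⟨g₁, by omega⟩, false), (h1l _).mpr (by simp only; exact le_rfl),
        fun h' => by have := (hml _).mp h'; simp only at this; omega⟩
    · exact ⟨Sum.inr ⟨0, by omega⟩, (h1r _).mpr (by simp only; omega),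
        fun h' => by have := (hmr _).mp h'; simp only at this; omega⟩
  -- the free-factor projections killing `S₀`, `S₁`
  let ρ₀ : PuncturedSurfaceGroup g (r' + 1) →* PuncturedSurfaceGroup g (r' + 1) :=
    bB.lift fun y => if y ∈ S₀ then 1 else bB y
  have hρ₀ : ∀ y, ρ₀ (bB y) = if y ∈ S₀ then 1 else bB y := fun y => lift_apply_basis bB _ y
  let ρ₁ : PuncturedSurfaceGroup g (r' + 1) →* PuncturedSurfaceGroup g (r' + 1) :=
    bB.lift fun y => if y ∈ S₁ then 1 else bB y
  have hρ₁ : ∀ y, ρ₁ (bB y) = if y ∈ S₁ then 1 else bB y := fun y => lift_apply_basis bB _ y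
  have hρ₁ε : ρ₁ εA ≠ 1 := by
    have hfix : Subgroup.closure (bB '' {y | y ∉ Sm ∧ y ∉ S₁}) ≤ ρ₁.eqLocus (MonoidHom.id _) := by
      rw [Subgroup.closure_le]
      rintro _ ⟨y, hy, rfl⟩
      change ρ₁ (bB y) = bB y
      rw [hρ₁, if_neg hy.2]
    have h := hfix hεmem
    change ρ₁ εA = εA at h
    rw [h]
    exact hε1
  refine G.verticialSeparatingCoverings_of_sameVertex_of_crossVertex (fun V hVn hVo v γ₁ γ₂ hne => ?_)
    (fun V hVn hVo w₁ w₂ γ₁ γ₂ h12 => ?_)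
  · -- same vertex
    haveI := hVn
    rcases hV v with rfl | rfl | rfl
    · exact freeFactor_exists_open_separating_sameVertex hι bB S₀ ⟨_, hκ0⟩ hℓ hℓS (G.vertGp v) hA₀ V hVo γ₁ γ₂
        hne
    · -- the middle vertex: cut-off twist with `Ψ = η^∨`
      let Ψ : PuncturedSurfaceGroup g (r' + 1) →* Multiplicative ℤ :=
        bB.lift fun y => if y = Sum.inr ⟨s₁ - 1, hslot⟩ then ofAdd 1 else 1
      have hΨ : ∀ y, Ψ (bB y) = if y = Sum.inr ⟨s₁ - 1, hslot⟩ then ofAdd 1 else 1 := fun y =>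
        lift_apply_basis bB _ y
      refine cutoff_exists_open_separating_sameVertex hι bB Sm Ψ (fun y hy => ?_) {εA} ?_ _ rfl hτBm ?_ hℓ hℓS
        (G.vertGp v) hAm V hVo γ₁ γ₂ hne
      · rw [hΨ, if_neg (fun h => hy (by rw [h]; exact hτBm))]
      · rw [Set.singleton_subset_iff]
        refine Subgroup.closure_mono (Set.image_mono fun y hy => ?_) hεmem
        exact fun h => absurd h hy.1
      · rw [hΨ, if_pos rfl]
        exact fun h => one_ne_zero (Multiplicative.ofAdd.injective (h.trans ofAdd_zero.symm))
    · exact freeFactor_exists_open_separating_sameVertex hι bB S₁ ⟨_, hτB1⟩ hℓ hℓS (G.vertGp v) hA₁ V hVo γ₁ γ₂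
        hne
  · -- different vertices
    haveI := hVn
    have hVi : IsSigmaInteger Sigma V.index := hι.index_open V hVn hVo
    have hmpos : 0 < V.index := hVi.1
    have hmlt : V.index < ℓ ^ V.index := Nat.lt_pow_self hℓ.one_lt
    haveI : NeZero (ℓ ^ V.index) := ⟨pow_ne_zero _ hℓ.ne_zero⟩
    have hZM : IsSigmaInteger Sigma (Nat.card (Multiplicative (ZMod (ℓ ^ V.index)))) := by
      rw [show Nat.card (Multiplicative (ZMod (ℓ ^ V.index))) = ℓ ^ V.index from Nat.card_zmod _]
      exact Literature.AnabelianGeometry.SemiGraphs.isSigmaInteger_prime_pow hℓ hℓS _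
    have hpow1 : (ofAdd (1 : ZMod (ℓ ^ V.index))) ^ V.index ≠ 1 := by
      rw [← ofAdd_nsmul, nsmul_eq_mul, mul_one, Ne, ofAdd_eq_one, ZMod.natCast_eq_zero_iff]
      exact fun h => absurd (Nat.le_of_dvd hmpos h) (not_le.mpr hmlt)
    -- a character dual to a letter `y₀ ∉ Sm` kills `Π_{v_mid}`
    have hkillm : ∀ (y₀ : (Fin g × Bool) ⊕ Fin r'), y₀ ∉ Sm →
        ∃ χ : PuncturedSurfaceGroup g (r' + 1) →* Multiplicative (ZMod (ℓ ^ V.index)),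
          χ (bB y₀) = ofAdd 1 ∧ ∀ x ∈ Subgroup.closure (bB '' Sm ∪ {εA}), χ x = 1 := by
      intro y₀ hy₀
      let χ : PuncturedSurfaceGroup g (r' + 1) →* Multiplicative (ZMod (ℓ ^ V.index)) :=
        bB.lift fun y => if y = y₀ then ofAdd 1 else 1
      have hχ : ∀ y, χ (bB y) = if y = y₀ then ofAdd 1 else 1 := fun y => lift_apply_basis bB _ y
      refine ⟨χ, by rw [hχ, if_pos rfl], fun x hx => ?_⟩
      refine (Subgroup.closure_le (K := χ.ker)).mpr ?_ hx
      rintro z (⟨y, hy, rfl⟩ | rfl)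
      · rw [SetLike.mem_coe, MonoidHom.mem_ker, hχ, if_neg (fun h : y = y₀ => hy₀ (by rw [← h]; exact hy))]
      · rw [SetLike.mem_coe, MonoidHom.mem_ker, hεx, map_list_prod, List.map_map]
        refine List.prod_eq_one fun w hw => ?_
        obtain ⟨i, -, rfl⟩ := List.mem_map.mp hw
        simp only [Function.comp_apply, apply_ite χ, map_one, map_mul, map_inv, mul_inv_cancel_comm,
          mul_inv_cancel, ite_self]
    by_cases h2 : w₂ = vm
    · -- killed: the middle vertex
      rw [h2] at h12 ⊢
      rcases hV w₁ with h1 | h1 | h1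
      · obtain ⟨χ, hχ1, hχ0⟩ := hkillm _ hκm
        exact exists_open_separating_of_hom hι hZM χ (G.vertGp vm) _ hAm hχ0 (G.vertGp w₁) (bB _)
          (by rw [h1, hA₀]; exact hcl' S₀ _ hκ0) V hVo (by rw [hχ1]; exact hpow1) γ₁ γ₂
      · exact absurd h1 h12
      · obtain ⟨χ, hχ1, hχ0⟩ := hkillm x₁ hx₁m
        exact exists_open_separating_of_hom hι hZM χ (G.vertGp vm) _ hAm hχ0 (G.vertGp w₁) (bB x₁)
          (by rw [h1, hA₁]; exact hcl' S₁ x₁ hx₁1) V hVo (by rw [hχ1]; exact hpow1) γ₁ γ₂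
    · by_cases h2' : w₂ = v₀
      · -- killed: `v₀` (free factor `S₀`); witness `η` (alive `v_mid` or `v₁`)
        rw [h2'] at h12 h2 ⊢
        have hρη : ρ₀ (bB (Sum.inr ⟨s₁ - 1, hslot⟩)) ≠ 1 := by
          rw [hρ₀, if_neg hτB0]; exact FreeGroupBasis.apply_ne_one _ _
        rcases hV w₁ with h1 | h1 | h1
        · exact absurd h1 h12
        · exact freeFactor_exists_open_separating_crossVertex hι hSig bB S₀ ρ₀ hρ₀ (G.vertGp v₀) hA₀
            (G.vertGp w₁) _ (by rw [h1, hAm]; exact hcl Sm {εA} _ hτBm) hρη V hVo γ₁ γ₂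
        · exact freeFactor_exists_open_separating_crossVertex hι hSig bB S₀ ρ₀ hρ₀ (G.vertGp v₀) hA₀
            (G.vertGp w₁) _ (by rw [h1, hA₁]; exact hcl' S₁ _ hτB1) hρη V hVo γ₁ γ₂
      · -- killed: `v₁` (free factor `S₁`); witnesses `a₀` (alive `v₀`), `ε_A` (alive `v_mid`)
        have hw₂ : w₂ = v₁ := by
          rcases hV w₂ with h | h | h
          · exact absurd h h2'
          · exact absurd h h2
          · exact h
        rw [hw₂] at h12 ⊢
        rcases hV w₁ with h1 | h1 | h1
        · refine freeFactor_exists_open_separating_crossVertex hι hSig bB S₁ ρ₁ hρ₁ (G.vertGp v₁) hA₁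
            (G.vertGp w₁) (bB (Sum.inl (⟨0, by omega⟩, false))) (by rw [h1, hA₀]; exact hcl' S₀ _ hκ0) ?_
            V hVo γ₁ γ₂
          rw [hρ₁, if_neg hκ1]
          exact FreeGroupBasis.apply_ne_one _ _
        · refine freeFactor_exists_open_separating_crossVertex hι hSig bB S₁ ρ₁ hρ₁ (G.vertGp v₁) hA₁
            (G.vertGp w₁) εA ?_ hρ₁ε V hVo γ₁ γ₂
          rw [h1, hAm]
          exact Subgroup.le_topologicalClosure _
            (Subgroup.mem_map_of_mem ι (Subgroup.subset_closure (Or.inr rfl)))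
        · exact absurd h1 h12

end PSCDatum

end Literature.AnabelianGeometry.SemiGraphs

end
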